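import Mathlib.Analysis.InnerProductSpace.Basic
import Mathlib.Algebra.Order.BigOperators.Group.Finset
import HarnessLib

/-!
# PF persistence — the ANTIDERIVATIVE TRANSFER: parity ordering from the smoothness of the odd ground state

pf seat gen 4 (cell `pub-rhpf`; mechanism/rigidity campaign; **no RH claims**).  Helper file for
`EvenOneSignedWindows` (stmt-RiemannHypothesis-19953): a typed CONDITIONAL mechanism, RH-free in its
hypotheses-as-stated, whose load-bearing hypothesis is what the explicit formula gives in RH-world.

## The mechanism

In the edge channel (`PfPersistenceAMPSaturation`: the first AMP failure is the edge zero, which is the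
`μ`-weighted mean of the even level `e = ε₁⁺` and the odd level `ε₁ = ε₁⁻`), one-signedness of the even
ground state `u_a` is EQUIVALENT to the parity ordering `ε₁⁺ < ε₁⁻`; the kinetic law only says where in
`(ε₁⁺, ε₁⁻)` the edge zero sits.  This file types a chain that forces the ordering:

* (domination) `γ₁² · Q(Ψ) ≤ Q(ψ)` whenever `Ψ' = ψ`, `Ψ(±a) = 0` — in RH-world this is the explicit formula
  `Q(f) = 2 Σ_{γ>0} |f̂(γ)|²` together with `ψ̂(γ) = -iγ Ψ̂(γ)` and `|γ| ≥ γ₁ = 14.1347…`; here it is the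
  finite-family lemma `sum_sq_domination` (weights `w_k ≥ 0`, nodes `γ_k² ≥ γ₁²`, `x_k = γ_k y_k`) and then a
  scalar hypothesis;
* (variational) `e · ‖Ψ‖² ≤ Q(Ψ)` — `Ψ` = antiderivative of the odd ground state `ψ₁` is an admissible EVEN
  Galerkin vector (a cosine polynomial plus the constant fixing `Ψ(a) = 0`);
* (Cauchy–Schwarz + parts) `‖ψ‖² = ⟨Ψ', ψ⟩ = -⟨Ψ, ψ'⟩ ≤ ‖Ψ‖ ‖ψ'‖`, i.e. `‖Ψ‖² ≥ ‖ψ‖⁴/‖ψ'‖²`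
  (`norm_sq_le_of_skew`, `norm_pow_four_le`);

hence `ε₁⁻ = Q(ψ₁) ≥ γ₁² ε₁⁺ / K(ψ₁)` with `K(ψ₁) = ‖ψ₁'‖²/‖ψ₁‖²` the kinetic (Rayleigh) quotient of the ODD
ground state (`oddLevel_ge_antiderivative`), and the parity ordering `ε₁⁺ < ε₁⁻` follows from the single
smoothness inequality `K(ψ₁) < γ₁²` (`parity_ordering_of_smooth_odd`): "the odd Weil ground state oscillates
slower than the first zeta zero".  The arithmetic enters only through `γ₁` and the positivity representation.
The differentiation direction gives the matching upper bound `ε₁⁻ ≤ Q(u')/‖u'‖² = ⟨γ²⟩_leak(u) ε₁⁺/K(u)`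
(`⟨γ²⟩_leak` = second moment of the leakage measure `|û(γ)|²` over the zeros), so
`γ₁²/K(ψ₁) ≤ ε₁⁻/ε₁⁺ ≤ ⟨γ²⟩_leak(u)/K(u)`.

## DATA (engine B `series` blocks, N = 60; scripts `musweep/antider.py`, `musweep/leak.py` of the pf g4 folder)

| a | ε₁⁻/ε₁⁺ | K(u) | K(ψ₁) | K(Ψ₁) | cos(Ψ₁,u) | γ₁²Q(Ψ₁) ≤ ε₁⁻ slack | bound γ₁²/K(ψ₁) | sharper γ₁²/K(Ψ₁) |
|---|---|---|---|---|---|---|---|---|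
| 0.55 | 293.6 | 14.14 | 40.27 | 14.45 | 0.99997 | ×7.8 | 4.96 | 13.8 |
| 0.70 | 628.5 | 12.78 | 36.13 | 12.86 | 0.9999974 | ×19.6 | 5.53 | 15.5 |
| 1.00 | 2470 | 11.43 | 32.56 | 11.45 | 0.99999988 | ×75 | 6.14 | 17.5 |
| 1.20 | 5710 | 10.99 | 31.40 | 10.99 | 0.99999998 | ×164 | 6.36 | 18.2 |

(needed for the ordering: bound `> 1`; for the kinetic margin `> 1 + 1/(4K(u)) ≈ 1.02`).  Explicit-formula
check at `a = 1.0`, `N = 60`, first 543 zeros: `2 Σ |û(γ_k)|² = 0.923 ε₁⁺`, `2 Σ |ψ̂₁(γ_k)|² = 0.960 ε₁⁻`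
(tails `∝ 1/γ`); `|û(γ_k)|` is suppressed below the edge asymptote `2θ_u(a)|sin γ_k a|/γ_k` by `4e-12 … 2e-5`
for `k ≤ 10` and is of its order from `k ≈ 50` on (rms leakage frequency `185`; upper bound `2991` vs `2470`).
Nothing here proves one-signedness: the domination hypothesis is RH-world, and the edge channel is DATA.

## The parity pencil (DATA; where the arithmetic enters)

Matrix form of the domination on the whole odd Galerkin space: `J : ℝ^N → ℝ^{N+1}` the antiderivative
with `(Jψ)(±a) = 0` (`(Jψ)_n = -ψ_n/k_n`, `(Jψ)_0 = √2 Σ ψ_n/k_n`, `k_n = πn/a`).  In RH-world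
`ψᵀQ₋ψ - Γ² (Jψ)ᵀQ₊(Jψ) = 2 Σ_k (γ_k² - Γ²)|Ψ̂(γ_k)|²`, so by min–max the generalized eigenvalues
`Γ₁² ≤ Γ₂² ≤ …` of the symmetric-definite pencil `(Q₋, JᵀQ₊J)` are UPPER bounds of `γ₁², γ₂², …` for every
`a, N`, and `λ_min(Q₋ - γ₁² JᵀQ₊J) ≥ 0`.  Measured (`musweep/domin.py`): `λ_min = +2.2e-8 / +1.2e-13 /
+6.1e-31` at `a = 0.55 / 0.7 / 1.0` (`N = 40`), and `Γ_k - γ_k` =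
`2.3e-28, 5.4e-25, 4.6e-23, 2.9e-20, 4.4e-19, 3.8e-17, 2.2e-15, 1.7e-14` (`k = 1…8`, `a = 1.0`, `N = 40`;
`N = 60` gives `2.0e-28 …`, i.e. the accuracy is set by the window), `2.1e-11, 1.5e-8, 5.0e-7, 6.5e-5, …`
(`a = 0.7`), `2.2e-6, 5.7e-4, 8.0e-3, 0.20, …` (`a = 0.55`) — all from above.  The bottom generalized
eigenvector at `a = 1.0` is a truncated sinusoid at frequency `γ₁` (`K(ψ) = 185.5`, coefficients on
`k₄ = 12.6 < γ₁ < k₅ = 15.7`) whose antiderivative leaks onto `γ₁` alone (`2Σ_{k≥2}|Ψ̂(γ_k)|² = 1.2e-23` vs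
`2|Ψ̂(γ₁)|² = 6.1e-3`).  This is a parity-split, squared form of the Connes–Consani–Moscovici zeta spectral
triple (arXiv:2511.22755, Thm 1.1 and §6: the rank-one boundary correction `D - |Dξ⟩⟨δ_N|` of `d/dx` has
spectrum converging to the zeros); the chain above is its `k = 1` inequality read at the odd ground state,
and the parity ordering it yields is the "even" half of their first missing step (§8: the smallest
eigenvalue of `QW_λ` should be simple with an EVEN eigenvector) — here CONDITIONAL on RH-world domination,
so it explains persistence in the positive class and proves nothing about RH.
-/

set_option linter.dupNamespace false  -- the mandated namespace repeats `RiemannHypothesis`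

noncomputable section

namespace Summit.RiemannHypothesis.RiemannHypothesis.Theorems.PolarPerronFrobenius

open scoped BigOperators RealInnerProductSpace

/-! ## 1. Finite-family domination: `x_k = γ_k y_k`, `γ_k² ≥ γ₁²`, `w_k ≥ 0` ⇒ `γ₁² Σ w y² ≤ Σ w x²` -/

/-- Finite-family domination: if `x_k = γ_k y_k`, `γ_k² ≥ γ₁²` and `w_k ≥ 0` on `s`, then
`γ₁² Σ w_k y_k² ≤ Σ w_k x_k²` (the explicit-formula reading: `y_k = Ψ̂(γ_k)`, `x_k = ψ̂(γ_k)/i`). -/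
theorem sum_sq_domination {ι : Type*} (s : Finset ι) (w γ x y : ι → ℝ) (γ₁ : ℝ)
    (hw : ∀ k ∈ s, 0 ≤ w k) (hγ : ∀ k ∈ s, γ₁ ^ 2 ≤ (γ k) ^ 2) (hxy : ∀ k ∈ s, x k = γ k * y k) :
    γ₁ ^ 2 * ∑ k ∈ s, w k * (y k) ^ 2 ≤ ∑ k ∈ s, w k * (x k) ^ 2 := by
  rw [Finset.mul_sum]
  refine Finset.sum_le_sum fun k hk => ?_
  rw [hxy k hk]
  have h1 : 0 ≤ w k * (y k) ^ 2 := mul_nonneg (hw k hk) (sq_nonneg _)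
  calc γ₁ ^ 2 * (w k * (y k) ^ 2) ≤ (γ k) ^ 2 * (w k * (y k) ^ 2) :=
        mul_le_mul_of_nonneg_right (hγ k hk) h1
    _ = w k * (γ k * y k) ^ 2 := by ring

/-- The matching second-moment identity for the differentiation direction: `Σ w x² = Σ (w γ²) y²`
(so `Q(u') = Σ_k w_k γ_k² |û(γ_k)|²`, the `⟨γ²⟩_leak` numerator). -/
theorem sum_sq_moment {ι : Type*} (s : Finset ι) (w γ x y : ι → ℝ)
    (hxy : ∀ k ∈ s, x k = γ k * y k) :
    ∑ k ∈ s, w k * (x k) ^ 2 = ∑ k ∈ s, (w k * (γ k) ^ 2) * (y k) ^ 2 :=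
  Finset.sum_congr rfl fun k hk => by rw [hxy k hk]; ring

/-! ## 2. Cauchy–Schwarz + parts: `‖ψ‖² ≤ ‖Ψ‖ ‖ψ'‖` -/

section skew

variable {E F : Type*} [NormedAddCommGroup E] [InnerProductSpace ℝ E]
  [NormedAddCommGroup F] [InnerProductSpace ℝ F]

/-- If `D Ψ = ψ` (Ψ is an antiderivative of ψ) and the pair integrates by parts without boundary term,
`⟪D Ψ, ψ⟫ = -⟪Ψ, D' ψ⟫` (`Ψ(±a) = 0`), then `‖ψ‖² ≤ ‖Ψ‖·‖D' ψ‖`. Here `D : E → F` differentiates even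
vectors and `D' : F → E` odd ones; only the two values `D Ψ`, `D' ψ` enter. -/
theorem norm_sq_le_of_skew {Ψ : E} {ψ : F} {DΨ : F} {D'ψ : E}
    (hD : DΨ = ψ) (hskew : ⟪DΨ, ψ⟫ = -⟪Ψ, D'ψ⟫) : ‖ψ‖ ^ 2 ≤ ‖Ψ‖ * ‖D'ψ‖ := by
  have h1 : ‖ψ‖ ^ 2 = -⟪Ψ, D'ψ⟫ := by
    rw [← hskew, hD, real_inner_self_eq_norm_sq]
  rw [h1]
  calc -⟪Ψ, D'ψ⟫ ≤ |⟪Ψ, D'ψ⟫| := neg_le_abs _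
    _ ≤ ‖Ψ‖ * ‖D'ψ‖ := abs_real_inner_le_norm _ _

/-- Squared form: `‖ψ‖⁴ ≤ ‖Ψ‖² ‖ψ'‖²`, i.e. `‖Ψ‖² ≥ ‖ψ‖⁴/‖ψ'‖² = ‖ψ‖²/K(ψ)`. -/
theorem norm_pow_four_le {Ψ : E} {ψ : F} {DΨ : F} {D'ψ : E}
    (hD : DΨ = ψ) (hskew : ⟪DΨ, ψ⟫ = -⟪Ψ, D'ψ⟫) : ‖ψ‖ ^ 4 ≤ ‖Ψ‖ ^ 2 * ‖D'ψ‖ ^ 2 := by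
  have h := norm_sq_le_of_skew hD hskew
  have h0 : 0 ≤ ‖ψ‖ ^ 2 := sq_nonneg _
  calc ‖ψ‖ ^ 4 = (‖ψ‖ ^ 2) ^ 2 := by ring
    _ ≤ (‖Ψ‖ * ‖D'ψ‖) ^ 2 := pow_le_pow_left₀ h0 h 2
    _ = ‖Ψ‖ ^ 2 * ‖D'ψ‖ ^ 2 := by ring

end skew

/-! ## 3. The chain and the parity ordering -/

/-- The chain: with `Qψ = Q(ψ₁)`, `QΨ = Q(Ψ₁)`, `nΨ2 = ‖Ψ₁‖²`, `nψ2 = ‖ψ₁‖²`, `Dψ2 = ‖ψ₁'‖²`,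
domination + variational + Cauchy–Schwarz ⇒ `γ₁² · e · ‖ψ₁‖⁴ ≤ Q(ψ₁) · ‖ψ₁'‖²`. -/
theorem oddLevel_ge_antiderivative {γ₁sq e Qψ QΨ nΨ2 nψ2 Dψ2 : ℝ}
    (hdom : γ₁sq * QΨ ≤ Qψ) (hvar : e * nΨ2 ≤ QΨ) (hcs : nψ2 ^ 2 ≤ nΨ2 * Dψ2)
    (hγ : 0 ≤ γ₁sq) (he : 0 ≤ e) (hD : 0 ≤ Dψ2) : γ₁sq * e * nψ2 ^ 2 ≤ Qψ * Dψ2 := by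
  have h1 : γ₁sq * e * nψ2 ^ 2 ≤ γ₁sq * e * (nΨ2 * Dψ2) :=
    mul_le_mul_of_nonneg_left hcs (mul_nonneg hγ he)
  have h2 : γ₁sq * (e * nΨ2) ≤ γ₁sq * QΨ := mul_le_mul_of_nonneg_left hvar hγ
  nlinarith [mul_le_mul_of_nonneg_right (h2.trans hdom) hD]

/-- PARITY ORDERING FROM SMOOTHNESS.  Normalise `‖ψ₁‖ = 1`, so `ε₁⁻ = Q(ψ₁)` and `K(ψ₁) = ‖ψ₁'‖²`.
If the even level is positive (`0 < e`, the positive class) and the odd ground state is smoother than the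
first zero, `K(ψ₁) < γ₁²`, then `e < ε₁⁻` — and in the edge channel this IS one-signedness of `u_a`
(`PfPersistenceAMPSaturation.edgeZero_mem_Ioo`).  DATA: `K(ψ₁) = 31–40 ≪ γ₁² = 199.79`. -/
theorem parity_ordering_of_smooth_odd {γ₁sq e ε₁ QΨ nΨ2 K : ℝ}
    (hdom : γ₁sq * QΨ ≤ ε₁) (hvar : e * nΨ2 ≤ QΨ) (hcs : (1 : ℝ) ^ 2 ≤ nΨ2 * K)
    (he : 0 < e) (hK : 0 < K) (hKγ : K < γ₁sq) : e < ε₁ := by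
  have hγ : 0 ≤ γ₁sq := le_trans hK.le hKγ.le
  have h := oddLevel_ge_antiderivative hdom hvar hcs hγ he.le hK.le
  have h1 : K * e < γ₁sq * e := mul_lt_mul_of_pos_right hKγ he
  have h2 : K * e < K * ε₁ := by nlinarith
  exact lt_of_mul_lt_mul_left h2 hK.le

/-- SHARPER ORDERING CRITERION (no Cauchy–Schwarz step): domination + variational give
`γ₁² e ‖Ψ₁‖² ≤ ε₁⁻` directly, so `e < ε₁⁻` as soon as `γ₁² ‖Ψ₁‖² > 1`, i.e. `K(Ψ₁) := ‖ψ₁‖²/‖Ψ₁‖² < γ₁²`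
(`K(Ψ₁) ≤ K(ψ₁)` by `norm_pow_four_le`; DATA `K(Ψ₁) = 14.45 / 12.86 / 11.45 / 10.99`, margin `×14–18`).
Also the partial-RH reading: the domination hypothesis at the single pair `(ψ₁, Ψ₁)` only needs the zeros
with `|Ψ̂₁(γ)|²` non-negligible to be on the line — `Ψ̂₁` decays like `|ψ₁'(a)|/γ³`. -/
theorem parity_ordering_of_antiderivative_norm {γ₁sq e ε₁ QΨ nΨ2 : ℝ}
    (hdom : γ₁sq * QΨ ≤ ε₁) (hvar : e * nΨ2 ≤ QΨ) (he : 0 < e) (hγ : 0 ≤ γ₁sq)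
    (hn : 1 < γ₁sq * nΨ2) : e < ε₁ := by
  have h2 : γ₁sq * (e * nΨ2) ≤ γ₁sq * QΨ := mul_le_mul_of_nonneg_left hvar hγ
  have h3 : e * (γ₁sq * nΨ2) ≤ ε₁ := by nlinarith
  nlinarith [mul_lt_mul_of_pos_left hn he]

/-- PARTIAL-RH FORM (what is really conditional). Unconditionally the explicit formula gives
`Q(ψ₁) − γ₁² Q(Ψ₁) = S_on + S_off`, where `S_on ≥ 0` collects the zeros on the line (all zeros with
`|γ| ≤ H = 3·10¹²`, Platt–Trudgian 2021) and `|S_off| ≤ J` the hypothetical off-line zeros above `H`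
(`|Ψ̂₁(γ − iδ)| ≤ 2cosh(a/2)|ψ₁'(a)|/|γ|³` and zero counting give `J ≈ 5·10⁻³⁷·ψ₁'(a)²`, negligible against
`ε₁⁻(a)` for all atlas windows `a ≤ 1.2`). So the domination holds up to `J`, and the ordering follows from the
coarse fact `γ₁²‖Ψ₁‖² > 1 + J/ε₁⁻`. DATA on WHY the fact is coarse and stable: the even / odd ground
states converge to Riemann's kernel `Φ = 2Σ(2π²n⁴e^{9x/2} − 3πn²e^{5x/2})e^{−πn²e^{2x}}` and to `Φ'`
(cosines `0.99964 / 0.99905` at `a = 1.2`), so `K_anti = 1/‖Ψ₁‖² ↓ K(Φ) = ‖Φ'‖²/‖Φ‖² = 10.2076` and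
`K(ψ₁) ↓ K(Φ') = 29.357`, against `γ₁² = 199.79` (HOME/PF.md §16.10; CCM arXiv:2511.22755 (7.6), Lemma 7.3).
Pure inequality bookkeeping: -/
theorem parity_ordering_with_junk {γ₁sq e ε₁ QΨ nΨ2 J : ℝ}
    (hdom : γ₁sq * QΨ ≤ ε₁ + J) (hvar : e * nΨ2 ≤ QΨ) (hγ : 0 ≤ γ₁sq)
    (hε : 0 < ε₁) (hJ : 0 ≤ J) (hn : ε₁ + J < γ₁sq * nΨ2 * ε₁) : e < ε₁ := by
  have h2 : γ₁sq * (e * nΨ2) ≤ γ₁sq * QΨ := mul_le_mul_of_nonneg_left hvar hγ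
  have hX : 1 < γ₁sq * nΨ2 := by
    by_contra hle
    have hle' : γ₁sq * nΨ2 ≤ 1 := not_lt.mp hle
    have : γ₁sq * nΨ2 * ε₁ ≤ 1 * ε₁ := mul_le_mul_of_nonneg_right hle' hε.le
    linarith
  have h3 : e * (γ₁sq * nΨ2) < ε₁ * (γ₁sq * nΨ2) := by nlinarith
  exact lt_of_mul_lt_mul_right h3 (by linarith)

/-- PARITY LOCKING (RH-world, with the T2 variational lemma as a hypothesis). The normalised
antiderivative `Ψ̃₁ = Ψ₁/‖Ψ₁‖` has Rayleigh quotient `R = Q(Ψ₁)/‖Ψ₁‖² ≤ ε₁⁻ K_anti/γ₁²` by domination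
(`‖ψ₁‖ = 1`, `Q(ψ₁) = ε₁⁻`, `K_anti = 1/‖Ψ₁‖²`), and the variational lemma (`M2_of_variational_ratio`, T2:
`sin²∠(u, k̃)·(ε₂⁺ − ε₁⁺) ≤ R(k̃) − ε₁⁺`) then glues the even ground state to it:
`sin²∠(u_a, Ψ̃₁) ≤ (ε₁⁻ K_anti/γ₁² − ε₁⁺)/(ε₂⁺ − ε₁⁺)`. DATA (a = 0.55 / 0.7 / 1.0 / 1.2): measured
`sin² = 6e-5 / 5.2e-6 / 2.4e-7 / 4e-8`, bound `8.1e-4 / 2.0e-4 / 3.6e-5 / 1.7e-5`. Stated with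
`nΨ2 = ‖Ψ₁‖²`, so `K_anti/γ₁² = 1/(γ₁² nΨ2)`: -/
theorem parity_locking {γ₁sq ε₁m e e₂ QΨ nΨ2 R sin2 : ℝ}
    (hdom : γ₁sq * QΨ ≤ ε₁m) (hR : R * nΨ2 = QΨ) (hT2 : sin2 * (e₂ - e) ≤ R - e)
    (hgap : e < e₂) (hγ : 0 < γ₁sq) (hn : 0 < nΨ2) :
    sin2 ≤ (ε₁m / (γ₁sq * nΨ2) - e) / (e₂ - e) := by
  have hpos : 0 < γ₁sq * nΨ2 := mul_pos hγ hn
  have hR' : R ≤ ε₁m / (γ₁sq * nΨ2) := by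
    rw [le_div_iff₀ hpos]
    nlinarith
  rw [le_div_iff₀ (sub_pos.mpr hgap)]
  linarith

/-- Quantitative form: the parity-gap RATIO is at least `γ₁²/K(ψ₁)`:  `γ₁² · e ≤ K(ψ₁) · ε₁⁻`
(DATA: `γ₁²/K(ψ₁) = 4.96 / 5.53 / 6.14 / 6.36` at `a = 0.55 / 0.7 / 1.0 / 1.2`, against the measured
`ε₁⁻/ε₁⁺ = 294 / 628 / 2470 / 5710` — true with room; the slack is the chain's, `×7.8 … ×164`). -/
theorem parity_gap_ratio_ge {γ₁sq e ε₁ QΨ nΨ2 K : ℝ}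
    (hdom : γ₁sq * QΨ ≤ ε₁) (hvar : e * nΨ2 ≤ QΨ) (hcs : (1 : ℝ) ^ 2 ≤ nΨ2 * K)
    (hγ : 0 ≤ γ₁sq) (he : 0 ≤ e) (hK : 0 ≤ K) : γ₁sq * e ≤ K * ε₁ := by
  have h := oddLevel_ge_antiderivative hdom hvar hcs hγ he hK
  nlinarith

end Summit.RiemannHypothesis.RiemannHypothesis.Theorems.PolarPerronFrobenius

end
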